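import Summits.QuantumFields.YangMills.Theorems.ColdStartUniversalityLatticeLangevinHopfLaxHypercontractiveStep
import Mathlib.Probability.Moments.SubGaussian
import HarnessLib

/-!
# HYPERCONTRACTIVITY OF THE HOPF–LAX SEMIGROUP, PART III: monotonicity of `H(t) = q(t)⁻¹ log ∫e^{q(t)Q_tf}dμ` and the DUAL TALAGRAND INEQUALITY
# `∫ e^{Q_C f} dμ ≤ e^{∫f dμ}` from a log-Sobolev inequality with local Lipschitz majorants (Otto–Villani / Bobkov–Gentil–Ledoux, BGL Thm 9.6.1)

Seat `ym-line-csu-p1` (g42), route `ColdStartUniversality` of `Summits/QuantumFields/YangMills`, helper file G69c (`--supports stmt-QuantumFields-24809`).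
GENERIC (compact metric space `X`, Borel probability measure `μ`).  Part II (G69b) gave the `O(δ²)` step for `H` along `q(t) = a + t/C`; telescoping
over `[t₀, T]` with a mesh constraint (G69a) makes `H` non-increasing; at `T = C(1 − a)` (`q(T) = 1`) this bounds `log ∫e^{Q_T f}dμ` by
`q(t₀)⁻¹ log ∫ e^{q(t₀) f} dμ ≤ ∫f dμ + q(t₀)M_f²/2` (Hoeffding's lemma, Mathlib `hasSubgaussianMGF_of_mem_Icc`), and `Q_C f ≤ Q_T f`, `a, t₀ → 0` give
the dual `T₂(C)` inequality.

* ★★★ `hopfLax_laplace_monotone` — `q(T)⁻¹ log ∫e^{q(T)Q_Tf}dμ ≤ q(t₀)⁻¹ log ∫e^{q(t₀)Q_{t₀}f}dμ` for `0 < t₀ ≤ T`;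
* ★ `log_integral_exp_le_of_abs_le` — Hoeffding: `q⁻¹ log ∫e^{qf}dμ ≤ ∫f dμ + qM_f²/2` for `|f| ≤ M_f`, `q > 0`;
* ★★★★ **`integral_exp_hopfLax_le`** — `∫ e^{Q_C f} dμ ≤ e^{∫ f dμ}`, `Q_C f(x) = inf_v [f(v) + d(x,v)²/(2C)]`, for every Lipschitz `f`
  (the dual form of `W₂(ν,μ)² ≤ 2C·KL(ν‖μ)`).

THEOREMS ONLY, no definition, no sorry.  HONEST FRAMING: abstract metric-measure lemmas; nothing here is specific to Yang–Mills; no crux, rung or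
summit statement is proved; the Yang–Mills mass gap is NOT proved.
-/

set_option autoImplicit false

noncomputable section

namespace Summit.QuantumFields.YangMills.Theorems.ColdStartUniversality

open MeasureTheory ProbabilityTheory Filter Topology Set Metric
open scoped BigOperators NNReal

variable {X : Type*} [MetricSpace X] [CompactSpace X] [MeasurableSpace X] [BorelSpace X]

/-! ## §1. Monotonicity of `H` -/

/-- ★★★ **`H` is non-increasing on `[t₀, T]`.**  Under the local-majorant LSI with constant `C > 0`, for continuous `L_f`-Lipschitz `f` with `|f| ≤ M_f`,
`a > 0` and `0 < t₀ ≤ T`:  `(a + T/C)⁻¹ log ∫e^{(a+T/C)Q_Tf}dμ ≤ (a + t₀/C)⁻¹ log ∫e^{(a+t₀/C)Q_{t₀}f}dμ` (telescoping of Part II's step with mesh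
`≤ 1/(h₀+1)`). [cite: BakryGentilLedoux2014, Thm 9.5.1] -/
theorem hopfLax_laplace_monotone (μ : Measure X) [IsProbabilityMeasure μ] {C : ℝ} (hC : 0 < C)
    (hLS : ∀ (F : X → ℝ) (Lf : ℝ), 0 ≤ Lf → (∀ z z' : X, |F z' - F z| ≤ Lf * dist z z') → ∀ (R : ℝ), 0 < R →
      ∀ (G : X → ℝ) (M : ℝ), UpperSemicontinuous G → (∀ w, 0 ≤ G w) → (∀ w, G w ≤ M) →
      (∀ w z' z'' : X, dist w z' ≤ R → dist w z'' ≤ R → |F z'' - F z'| ≤ G w * dist z' z'') →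
      ∫ x, F x * Real.exp (F x) ∂μ - (∫ x, Real.exp (F x) ∂μ) * Real.log (∫ x, Real.exp (F x) ∂μ) ≤ C / 2 * ∫ x, G x ^ 2 * Real.exp (F x) ∂μ)
    {f : X → ℝ} (hf : Continuous f) {Lf : ℝ} (hLf : 0 ≤ Lf) (hlip : ∀ z w, |f z - f w| ≤ Lf * dist z w) {Mf : ℝ} (hMf : ∀ z, |f z| ≤ Mf)
    {a t₀ T : ℝ} (ha : 0 < a) (ht₀ : 0 < t₀) (ht₀T : t₀ ≤ T) :
    1 / (a + T / C) * Real.log (∫ x, Real.exp ((a + T / C) * ⨅ v, (f v + dist x v ^ 2 / (2 * T))) ∂μ) ≤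
      1 / (a + t₀ / C) * Real.log (∫ x, Real.exp ((a + t₀ / C) * ⨅ v, (f v + dist x v ^ 2 / (2 * t₀))) ∂μ) := by
  -- the function `h(s) = H(t₀ + s(T − t₀))`
  obtain ⟨K₀, hK₀⟩ : ∃ K₀ : ℝ, K₀ = 2 * Lf ^ 2 / t₀ + Real.exp ((a + T / C) * Mf) * Real.exp ((a + T / C) * Mf) * (Mf / C + 2 * (a + T / C) * Lf ^ 2) ^ 2 / a := ⟨_, rfl⟩
  obtain ⟨h₀, hh₀⟩ : ∃ h₀ : ℝ, h₀ = Mf / C + 2 * (a + T / C) * Lf ^ 2 := ⟨_, rfl⟩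
  have hne : Nonempty X := by
    by_contra hX
    rw [not_nonempty_iff] at hX
    have h1 := measure_univ (μ := μ)
    rw [Set.univ_eq_empty_iff.mpr hX, measure_empty] at h1
    exact zero_ne_one h1
  have hMf0 : 0 ≤ Mf := (abs_nonneg _).trans (hMf (Classical.arbitrary X))
  have hT0 : 0 < T := lt_of_lt_of_le ht₀ ht₀T
  have hh₀0 : 0 ≤ h₀ := by rw [hh₀]; positivity
  have hK₀0 : 0 ≤ K₀ := by rw [hK₀]; positivity
  have hTt : 0 ≤ T - t₀ := by linarith
  have key := sub_le_of_small_step_bound (h := fun s => 1 / (a + (t₀ + s * (T - t₀)) / C) *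
      Real.log (∫ x, Real.exp ((a + (t₀ + s * (T - t₀)) / C) * ⨅ v, (f v + dist x v ^ 2 / (2 * (t₀ + s * (T - t₀))))) ∂μ))
    (s₀ := 0) (C := 0) (K := K₀ * (T - t₀) ^ 2) (η := 1 / ((h₀ + 1) * (T - t₀ + 1))) zero_le_one (by positivity) ?_
  · simp only [zero_mul, add_zero, one_mul, add_sub_cancel, sub_zero, mul_zero] at key
    linarith
  · intro s s' hs hss' hs'1 hsmallη
    have hτ₀ : t₀ ≤ t₀ + s * (T - t₀) := by nlinarith
    have hττ' : t₀ + s * (T - t₀) ≤ t₀ + s' * (T - t₀) := by nlinarith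
    have hτ'T : t₀ + s' * (T - t₀) ≤ T := by nlinarith
    have hdiff : t₀ + s' * (T - t₀) - (t₀ + s * (T - t₀)) = (s' - s) * (T - t₀) := by ring
    have hsmall : (t₀ + s' * (T - t₀) - (t₀ + s * (T - t₀))) * (Mf / C + 2 * (a + T / C) * Lf ^ 2 + 1) ≤ 1 := by
      rw [hdiff, ← hh₀]
      have h1 : (s' - s) * (T - t₀) ≤ 1 / ((h₀ + 1) * (T - t₀ + 1)) * (T - t₀) := mul_le_mul_of_nonneg_right hsmallη hTt
      have h2 : 1 / ((h₀ + 1) * (T - t₀ + 1)) * (T - t₀) * (h₀ + 1) ≤ 1 := by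
        rw [show 1 / ((h₀ + 1) * (T - t₀ + 1)) * (T - t₀) * (h₀ + 1) = (T - t₀) / (T - t₀ + 1) by field_simp]
        rw [div_le_one (by linarith)]; linarith
      have h3 : 0 ≤ h₀ + 1 := by linarith
      nlinarith [mul_le_mul_of_nonneg_right h1 h3]
    have hstep := hopfLax_laplace_step μ hC hLS hf hLf hlip hMf ha ht₀ hτ₀ hττ' hτ'T hsmall
    rw [hdiff, ← hK₀] at hstep
    have hss'0 : 0 ≤ s' - s := by linarith
    have hss'1 : s' - s ≤ 1 := by linarith
    have hsq : (s' - s) ^ 2 ≤ (s' - s) * Real.sqrt (s' - s) := by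
      have h1 : s' - s ≤ Real.sqrt (s' - s) := by
        have h := Real.sqrt_le_sqrt hss'1
        rw [Real.sqrt_one] at h
        calc s' - s = Real.sqrt (s' - s) * Real.sqrt (s' - s) := (Real.mul_self_sqrt hss'0).symm
          _ ≤ Real.sqrt (s' - s) * 1 := mul_le_mul_of_nonneg_left h (Real.sqrt_nonneg _)
          _ = Real.sqrt (s' - s) := mul_one _
      rw [sq]; exact mul_le_mul_of_nonneg_left h1 hss'0
    have hfin : ((s' - s) * (T - t₀)) ^ 2 * K₀ ≤ (s' - s) * 0 + (s' - s) * Real.sqrt (s' - s) * (K₀ * (T - t₀) ^ 2) := by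
      rw [mul_zero, zero_add, mul_pow]
      have := mul_le_mul_of_nonneg_right hsq (by positivity : (0 : ℝ) ≤ (T - t₀) ^ 2 * K₀)
      linarith [this]
    exact hstep.trans hfin

/-! ## §2. Hoeffding's lemma in logarithmic form -/

omit [MetricSpace X] [CompactSpace X] [BorelSpace X] in
/-- ★ **Hoeffding**: for measurable `f` with `|f| ≤ M_f` and `q > 0`, `q⁻¹ log ∫e^{qf}dμ ≤ ∫f dμ + q·M_f²/2`. [folklore] -/
theorem log_integral_exp_le_of_abs_le (μ : Measure X) [IsProbabilityMeasure μ] {f : X → ℝ} (hfm : Measurable f) {Mf : ℝ} (hMf : ∀ z, |f z| ≤ Mf)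
    {q : ℝ} (hq : 0 < q) :
    1 / q * Real.log (∫ x, Real.exp (q * f x) ∂μ) ≤ ∫ x, f x ∂μ + q * Mf ^ 2 / 2 := by
  have hb : ∀ᵐ x ∂μ, f x ∈ Set.Icc (-Mf) Mf := ae_of_all _ fun x => abs_le.1 (hMf x)
  have hsg := hasSubgaussianMGF_of_mem_Icc hfm.aemeasurable hb
  have hmgf := hsg.mgf_le q
  have hc : (((‖Mf - -Mf‖₊ / 2) ^ 2 : ℝ≥0) : ℝ) = Mf ^ 2 := by
    have hMf0 : 0 ≤ Mf := by
      by_contra hneg; push Not at hneg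
      have hne : Nonempty X := by
        by_contra hX
        rw [not_nonempty_iff] at hX
        have h1 := measure_univ (μ := μ)
        rw [Set.univ_eq_empty_iff.mpr hX, measure_empty] at h1
        exact zero_ne_one h1
      have := hMf (Classical.arbitrary X)
      linarith [abs_nonneg (f (Classical.arbitrary X))]
    push_cast
    rw [Real.norm_eq_abs, show Mf - -Mf = 2 * Mf by ring, abs_of_nonneg (by linarith)]
    ring
  rw [hc] at hmgf
  -- `mgf (f − ∫f) q = e^{−q∫f} ∫ e^{qf}`
  have hfi : Integrable f μ := Integrable.of_mem_Icc (-Mf) Mf hfm.aemeasurable hb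
  have hmgf_eq : mgf (fun x => f x - ∫ y, f y ∂μ) μ q = Real.exp (-(q * ∫ y, f y ∂μ)) * ∫ x, Real.exp (q * f x) ∂μ := by
    rw [mgf, ← integral_const_mul]
    refine integral_congr_ae (ae_of_all _ fun x => ?_)
    show Real.exp (q * (f x - ∫ y, f y ∂μ)) = Real.exp (-(q * ∫ y, f y ∂μ)) * Real.exp (q * f x)
    rw [← Real.exp_add]; ring_nf
  rw [hmgf_eq] at hmgf
  have hI0 : 0 < ∫ x, Real.exp (q * f x) ∂μ := by
    have hE : ∀ x, Real.exp (-(q * Mf)) ≤ Real.exp (q * f x) := fun x => Real.exp_le_exp.2 (by nlinarith [(abs_le.1 (hMf x)).1])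
    have hEi : Integrable (fun x => Real.exp (q * f x)) μ := by
      refine (memLp_of_bounded (a := Real.exp (-(q * Mf))) (b := Real.exp (q * Mf)) (ae_of_all _ fun x => ⟨hE x, Real.exp_le_exp.2 ?_⟩)
        ((Real.measurable_exp.comp (hfm.const_mul q)).aestronglyMeasurable) 1).integrable le_rfl
      nlinarith [(abs_le.1 (hMf x)).2]
    calc (0 : ℝ) < ∫ _x, Real.exp (-(q * Mf)) ∂μ := by rw [integral_const, probReal_univ, one_smul]; exact Real.exp_pos _
      _ ≤ ∫ x, Real.exp (q * f x) ∂μ := integral_mono (integrable_const _) hEi hE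
  -- take logarithms
  have h1 : Real.exp (-(q * ∫ y, f y ∂μ)) * ∫ x, Real.exp (q * f x) ∂μ ≤ Real.exp (Mf ^ 2 * q ^ 2 / 2) := hmgf
  have h2 : ∫ x, Real.exp (q * f x) ∂μ ≤ Real.exp (q * ∫ y, f y ∂μ + Mf ^ 2 * q ^ 2 / 2) := by
    rw [Real.exp_add]
    have h3 := mul_le_mul_of_nonneg_left h1 (Real.exp_pos (q * ∫ y, f y ∂μ)).le
    rw [← mul_assoc, ← Real.exp_add, show q * ∫ y, f y ∂μ + -(q * ∫ y, f y ∂μ) = 0 by ring, Real.exp_zero, one_mul] at h3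
    exact h3
  have h4 : Real.log (∫ x, Real.exp (q * f x) ∂μ) ≤ q * ∫ y, f y ∂μ + Mf ^ 2 * q ^ 2 / 2 := by
    rw [← Real.log_exp (q * ∫ y, f y ∂μ + Mf ^ 2 * q ^ 2 / 2)]
    exact Real.log_le_log hI0 h2
  calc 1 / q * Real.log (∫ x, Real.exp (q * f x) ∂μ) ≤ 1 / q * (q * ∫ y, f y ∂μ + Mf ^ 2 * q ^ 2 / 2) :=
        mul_le_mul_of_nonneg_left h4 (by positivity)
    _ = ∫ x, f x ∂μ + q * Mf ^ 2 / 2 := by field_simp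

/-! ## §3. The dual Talagrand inequality -/

/-- ★★★★ **Dual `T₂(C)` inequality (Otto–Villani / Bobkov–Gentil–Ledoux).**  If `μ` satisfies the log-Sobolev inequality with local Lipschitz
majorants and constant `C > 0` (`Ent_μ(e^F) ≤ (C/2)∫G²e^F dμ`), then for every Lipschitz `f`:
`∫ exp(inf_v [f(v) + d(x,v)²/(2C)]) dμ(x) ≤ exp(∫ f dμ)`. [cite: BakryGentilLedoux2014, Thm 9.6.1] -/
theorem integral_exp_hopfLax_le (μ : Measure X) [IsProbabilityMeasure μ] {C : ℝ} (hC : 0 < C)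
    (hLS : ∀ (F : X → ℝ) (Lf : ℝ), 0 ≤ Lf → (∀ z z' : X, |F z' - F z| ≤ Lf * dist z z') → ∀ (R : ℝ), 0 < R →
      ∀ (G : X → ℝ) (M : ℝ), UpperSemicontinuous G → (∀ w, 0 ≤ G w) → (∀ w, G w ≤ M) →
      (∀ w z' z'' : X, dist w z' ≤ R → dist w z'' ≤ R → |F z'' - F z'| ≤ G w * dist z' z'') →
      ∫ x, F x * Real.exp (F x) ∂μ - (∫ x, Real.exp (F x) ∂μ) * Real.log (∫ x, Real.exp (F x) ∂μ) ≤ C / 2 * ∫ x, G x ^ 2 * Real.exp (F x) ∂μ)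
    {f : X → ℝ} (hf : Continuous f) {Lf : ℝ} (hLf : 0 ≤ Lf) (hlip : ∀ z w, |f z - f w| ≤ Lf * dist z w) :
    ∫ x, Real.exp (⨅ v, (f v + dist x v ^ 2 / (2 * C))) ∂μ ≤ Real.exp (∫ x, f x ∂μ) := by
  have hne : Nonempty X := by
    by_contra hX
    rw [not_nonempty_iff] at hX
    have h1 := measure_univ (μ := μ)
    rw [Set.univ_eq_empty_iff.mpr hX, measure_empty] at h1
    exact zero_ne_one h1
  -- a bound for `f`
  obtain ⟨Mf, hMf'⟩ := (isCompact_range (continuous_abs.comp hf)).bddAbove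
  have hMf : ∀ z, |f z| ≤ Mf := fun z => hMf' ⟨z, rfl⟩
  have hMf0 : 0 ≤ Mf := (abs_nonneg _).trans (hMf (Classical.arbitrary X))
  -- integrability / positivity of the Laplace functionals
  have hQCc : Continuous fun x => ⨅ v, (f v + dist x v ^ 2 / (2 * C)) := hopfLax_continuous hf hLf hlip hC
  have hI0 : 0 < ∫ x, Real.exp (⨅ v, (f v + dist x v ^ 2 / (2 * C))) ∂μ := by
    have hEi : Integrable (fun x => Real.exp (⨅ v, (f v + dist x v ^ 2 / (2 * C)))) μ :=
      (Real.continuous_exp.comp hQCc).integrable_of_hasCompactSupport (HasCompactSupport.of_compactSpace _)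
    have hlow : ∀ x, Real.exp (-Mf) ≤ Real.exp (⨅ v, (f v + dist x v ^ 2 / (2 * C))) := by
      intro x
      obtain ⟨w, hw, -⟩ := hopfLax_exists_farthest hf C x
      rw [hopfLax_eq_of_isMinOn hf hw]
      refine Real.exp_le_exp.2 ?_
      have h1 : -Mf ≤ f w := (abs_le.1 (hMf w)).1
      have h2 : 0 ≤ dist x w ^ 2 / (2 * C) := by positivity
      linarith
    calc (0 : ℝ) < ∫ _x, Real.exp (-Mf) ∂μ := by rw [integral_const, probReal_univ, one_smul]; exact Real.exp_pos _
      _ ≤ _ := integral_mono (integrable_const _) hEi hlow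
  -- it suffices to bound the logarithm
  rw [← Real.exp_log hI0, Real.exp_le_exp]
  refine le_of_forall_pos_le_add fun ε hε => ?_
  -- parameters: `a = s`, `t₀ = Cs`, `T = C(1 − s)`, `q(T) = 1`
  obtain ⟨s, hs⟩ : ∃ s : ℝ, s = min (1 / 4) (ε / (2 * (Mf ^ 2 + 1))) := ⟨_, rfl⟩
  have hs0 : 0 < s := by rw [hs]; exact lt_min (by norm_num) (by positivity)
  have hs4 : s ≤ 1 / 4 := by rw [hs]; exact min_le_left _ _
  have hsε : s * (2 * (Mf ^ 2 + 1)) ≤ ε := by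
    have : s ≤ ε / (2 * (Mf ^ 2 + 1)) := by rw [hs]; exact min_le_right _ _
    rwa [le_div_iff₀ (by positivity)] at this
  have ht₀ : 0 < C * s := mul_pos hC hs0
  have hT : C * s ≤ C * (1 - s) := mul_le_mul_of_nonneg_left (by linarith) hC.le
  have hmono := hopfLax_laplace_monotone μ hC hLS hf hLf hlip hMf hs0 ht₀ hT
  have eqT : s + C * (1 - s) / C = 1 := by field_simp; ring
  have eq₀ : s + C * s / C = 2 * s := by field_simp; ring
  rw [eqT, eq₀, one_div_one, one_mul] at hmono
  simp only [one_mul] at hmono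
  -- `Q_C f ≤ Q_T f` (`T = C(1−s) ≤ C`)
  have hTC : C * (1 - s) ≤ C := by nlinarith
  have hT0 : 0 < C * (1 - s) := by nlinarith
  have hQCT : ∀ x, (⨅ v, (f v + dist x v ^ 2 / (2 * C))) ≤ ⨅ v, (f v + dist x v ^ 2 / (2 * (C * (1 - s)))) := by
    intro x
    have h := hopfLax_time_le hf hT0 hTC x
    have h0 : 0 ≤ (C - C * (1 - s)) / (2 * (C * (1 - s)) * C) *
        sSup ((fun w => dist x w) '' {w | ∀ w' : X, f w + dist x w ^ 2 / (2 * (C * (1 - s))) ≤ f w' + dist x w' ^ 2 / (2 * (C * (1 - s)))}) ^ 2 :=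
      mul_nonneg (div_nonneg (by linarith) (by positivity)) (sq_nonneg _)
    linarith
  have hQTc : Continuous fun x => ⨅ v, (f v + dist x v ^ 2 / (2 * (C * (1 - s)))) := hopfLax_continuous hf hLf hlip hT0
  have hstep1 : Real.log (∫ x, Real.exp (⨅ v, (f v + dist x v ^ 2 / (2 * C))) ∂μ) ≤
      Real.log (∫ x, Real.exp (⨅ v, (f v + dist x v ^ 2 / (2 * (C * (1 - s))))) ∂μ) := by
    refine Real.log_le_log hI0 (integral_mono ((Real.continuous_exp.comp hQCc).integrable_of_hasCompactSupport (HasCompactSupport.of_compactSpace _))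
      ((Real.continuous_exp.comp hQTc).integrable_of_hasCompactSupport (HasCompactSupport.of_compactSpace _)) fun x => Real.exp_le_exp.2 (hQCT x))
  -- `Q_{t₀} f ≤ f`
  have hQ₀c : Continuous fun x => ⨅ v, (f v + dist x v ^ 2 / (2 * (C * s))) := hopfLax_continuous hf hLf hlip ht₀
  have hstep3 : 1 / (2 * s) * Real.log (∫ x, Real.exp ((2 * s) * ⨅ v, (f v + dist x v ^ 2 / (2 * (C * s)))) ∂μ) ≤
      1 / (2 * s) * Real.log (∫ x, Real.exp ((2 * s) * f x) ∂μ) := by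
    refine mul_le_mul_of_nonneg_left ?_ (by positivity)
    have hEi : Integrable (fun x => Real.exp ((2 * s) * ⨅ v, (f v + dist x v ^ 2 / (2 * (C * s))))) μ :=
      (Real.continuous_exp.comp (continuous_const.mul hQ₀c)).integrable_of_hasCompactSupport (HasCompactSupport.of_compactSpace _)
    have hEfi : Integrable (fun x => Real.exp ((2 * s) * f x)) μ :=
      (Real.continuous_exp.comp (continuous_const.mul hf)).integrable_of_hasCompactSupport (HasCompactSupport.of_compactSpace _)
    have hpos : 0 < ∫ x, Real.exp ((2 * s) * ⨅ v, (f v + dist x v ^ 2 / (2 * (C * s)))) ∂μ := by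
      have hlow : ∀ x, Real.exp ((2 * s) * (-Mf)) ≤ Real.exp ((2 * s) * ⨅ v, (f v + dist x v ^ 2 / (2 * (C * s)))) := by
        intro x
        obtain ⟨w, hw, -⟩ := hopfLax_exists_farthest hf (C * s) x
        rw [hopfLax_eq_of_isMinOn hf hw]
        refine Real.exp_le_exp.2 (mul_le_mul_of_nonneg_left ?_ (by linarith))
        have h1 : -Mf ≤ f w := (abs_le.1 (hMf w)).1
        have h2 : 0 ≤ dist x w ^ 2 / (2 * (C * s)) := by positivity
        linarith
      calc (0 : ℝ) < ∫ _x, Real.exp ((2 * s) * (-Mf)) ∂μ := by rw [integral_const, probReal_univ, one_smul]; exact Real.exp_pos _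
        _ ≤ _ := integral_mono (integrable_const _) hEi hlow
    exact Real.log_le_log hpos (integral_mono hEi hEfi fun x => Real.exp_le_exp.2 (mul_le_mul_of_nonneg_left (hopfLax_le_self hf _ x) (by linarith)))
  have hstep4 := log_integral_exp_le_of_abs_le μ hf.measurable hMf (q := 2 * s) (by linarith)
  have herr : (2 * s) * Mf ^ 2 / 2 ≤ ε := by nlinarith [sq_nonneg Mf]
  linarith

end Summit.QuantumFields.YangMills.Theorems.ColdStartUniversality

end
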